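import Literature.NumberTheory.Automorphic.ArchCoeffComplexPlaceCasimir
import HarnessLib

/-!
# The differential `A = dV_wt` of the algebraic representation `V_wt(ℂ)` of `GLₙ(ℂ)` on all of
# `𝔤𝔩ₙ(ℂ)`, and the Casimir scalar of `V_wt(ℂ)`

Topic `NumberTheory/Automorphic`; namespace `Literature.NumberTheory.Automorphic.AlgDiff`.
Definitions with bodies and theorems; no named fact, no `sorry`.

`ArchCoeffComplexPlaceCasimir` realises the differential `A(Y) = L(Y) + λ_{n-1} tr(Y)` of
`V_wt(ℂ) = S_μ(ℂⁿ) ⊗ det^{λ_{n-1}}` only through the factor at a COMPLEX place of a number field.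
Here the same construction is run for the real matrix group `GLₙ(ℂ)` itself
(`RealMatrixGroup.gl ℂ (Fin n)`, `φ = id`), so that `A` is available on all of `𝔤𝔩ₙ(ℂ)` for every
number field (in particular totally real ones):

* `cStdPowRep/cStdPowLie` (tensor power of the standard representation, `cStdPowRep_apply`,
  `cStdPowLie_eq_leib`), `algRep wt` (`= coeffRepGL` on `GLₙ(ℂ)`), `algLieG wt` (its differential
  on the Lie algebra of the matrix group), `isDifferentiableRep_alg`;
* **`algDiff wt : 𝔤𝔩ₙ(ℂ) →ₗ⁅ℝ⁆ End V_wt(ℂ)`**, `tens_algDiff` (`A(Y) = L(Y) + λ_{n-1} tr(Y)` on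
  tensors), `algDiff_smul` (complex-linearity), **`factorLie_eq_algDiff`**: the factor differential
  of `ArchCoefficientModule` at ANY embedding `τ` is `dV_{wt}(τ̃ X) = algDiff wt (X.map τ̃)`;
* `coeffRepGL_conj_algDiff` (`V(g) A(Y) V(g)⁻¹ = A(gYg⁻¹)`), the Casimir operator
  `casAlgD wt = ∑_{a,b} A(E_ab) A(E_ba)`, `lift_algDiff_casPlus`, `lift_algDiff_casPlus_comm` and
  **`exists_casAlgD_eq_smul`**: `C^alg` is a scalar on `V_wt(ℂ)` (Schur, `isIrreducible_weylRep_holds`).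

[cite: BorelWallach2000, 0 §2.3, §2.5] [cite: FultonHarrisGTM129, Thm. 6.3 (4)]

## References

* A. Borel, N. Wallach (2000), 0 §2.3–2.5 (held). [BorelWallach2000]
* W. Fulton, J. Harris, *Representation Theory*, GTM 129 (1991), Thm. 6.3. [FultonHarrisGTM129]
* A. W. Knapp, *Lie Groups Beyond an Introduction* (2002), §V.4 (5.24). [Knapp2002]
-/

noncomputable section

-- Mathlib idiom (Mathlib/Algebra/Lie/OfAssociative.lean), as in `GKModules` / `ArchCoefficientModule`.
attribute [local instance 100] LieRing.ofAssociativeRing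

open scoped Matrix ComplexConjugate TensorProduct
open Complex UniversalEnvelopingAlgebra

namespace Literature.NumberTheory.Automorphic

namespace AlgDiff

open scoped Classical
open _root_.NumberField _root_.NumberField.InfinitePlace _root_.NumberField.mixedEmbedding GLnComplexCasimir
open RealMatrixGroup ParallelWeight GLnCohomology Literature.NumberTheory.DiophantineGeometry PiTensor ComplexPlace

variable (n : ℕ) (wt : Fin n → ℤ)

/-- `GLₙ(ℂ)` as a real matrix group (all of `GL (Fin n) ℂ`, Lie algebra all of `𝔤𝔩ₙ(ℂ)`). [folklore] -/
abbrev GLC : RealMatrixGroup ℂ (Fin n) := RealMatrixGroup.gl ℂ (Fin n)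

/-- A complex matrix as an element of the Lie algebra of `GLC n`. [folklore] -/
def toLie : Matrix (Fin n) (Fin n) ℂ →ₗ⁅ℝ⁆ (GLC n).lie :=
  { toFun := fun Y => ⟨Y, show Y ∈ (⊤ : LieSubalgebra ℝ _) from trivial⟩
    map_add' := fun _ _ => rfl
    map_smul' := fun _ _ => rfl
    map_lie' := fun {_ _} => rfl }

/-- Unfolding. [folklore] -/
@[simp] theorem coe_toLie (Y : Matrix (Fin n) (Fin n) ℂ) : ((toLie n Y : (GLC n).lie) : Matrix (Fin n) (Fin n) ℂ) = Y := rfl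

/-- An invertible complex matrix as an element of `GLC n`. [folklore] -/
def toGLC (g : GL (Fin n) ℂ) : (GLC n).carrier := ⟨g, show g ∈ (⊤ : Subgroup _) from trivial⟩

/-- Unfolding. [folklore] -/
@[simp] theorem coe_toGLC (g : GL (Fin n) ℂ) : ((toGLC n g : (GLC n).carrier) : GL (Fin n) ℂ) = g := rfl

/-! ### The tensor power of the standard representation of `GLₙ(ℂ)` -/

/-- `(ℂⁿ)^{⊗d}` with `GLₙ(ℂ)` acting diagonally. [cite: BorelWallach2000, 0 §2.3] -/
def cStdPowRep (d : ℕ) : Representation ℂ (GLC n).carrier (TensorPower ℂ d (Fin n → ℂ)) :=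
  PiTensor.piRep (GLC n) fun _ : Fin d => phiStdRep (GLC n) (AlgHom.id ℝ ℂ)

/-- Its Leibniz differential. [cite: BorelWallach2000, 0 §2.3] -/
def cStdPowLie (d : ℕ) : (GLC n).lie →ₗ⁅ℝ⁆ Module.End ℂ (TensorPower ℂ d (Fin n → ℂ)) :=
  PiTensor.piLie (GLC n) fun _ : Fin d => phiStdLie (GLC n) (AlgHom.id ℝ ℂ)

/-- `cStdPowRep` is `glTensorRep`. [folklore] -/
theorem cStdPowRep_apply (d : ℕ) (g : (GLC n).carrier) :
    cStdPowRep n d g = glTensorRep (Fin n) ℂ d (g : GL (Fin n) ℂ) := by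
  refine PiTensorProduct.ext (MultilinearMap.ext fun v => ?_)
  simp only [LinearMap.compMultilinearMap_apply, cStdPowRep, PiTensor.piRep_tprod, phiStdRep_apply,
    glTensorRep_tprod, AlgHom.coe_id, Matrix.map_id]

/-- `cStdPowLie Y = L(Y)`. [folklore] -/
theorem cStdPowLie_eq_leib (d : ℕ) (Y : (GLC n).lie) :
    cStdPowLie n d Y = leib n d (Y : Matrix (Fin n) (Fin n) ℂ) := by
  rw [cStdPowLie, PiTensor.piLie_apply, leib]
  exact Finset.sum_congr rfl fun i _ => rfl

/-- The Weyl module is `GLₙ(ℂ)`-stable. [folklore] -/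
theorem cWeylModule_le_comap {d : ℕ} (μ : Nat.Partition d) (g : (GLC n).carrier) :
    weylModule ℂ (Fin n) μ ≤ (weylModule ℂ (Fin n) μ).comap (cStdPowRep n d g) := by
  intro x hx
  rw [Submodule.mem_comap, cStdPowRep_apply]
  exact glTensorRep_mem_weylModule ℂ (Fin n) μ _ hx

/-- `(ℂⁿ)^{⊗d}` is a differentiable representation of `GLₙ(ℂ)`. [cite: BorelWallach2000, 0 §2.3] -/
theorem isDifferentiableRep_cStdPow (d : ℕ) : IsDifferentiableRep (GLC n) (cStdPowRep n d) (cStdPowLie n d) :=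
  PiTensor.isDifferentiableRep (GLC n) _ _ fun _ => isDifferentiableRep_phiStd (GLC n) (AlgHom.id ℝ ℂ) continuous_id

/-! ### `V_wt(ℂ)` as a differentiable representation of `GLₙ(ℂ)` -/

/-- `V_wt(ℂ)` (`coeffRepGL`) as a representation of the matrix group `GLC n`. [cite: Harder1987, §1.1] -/
def algRep : Representation ℂ (GLC n).carrier (GLnCohomology.CoeffModule ℂ n wt) :=
  (GLnCohomology.coeffRepGL ℂ n wt).comp (GLC n).carrier.subtype

/-- Unfolding. [folklore] -/
theorem algRep_apply (g : (GLC n).carrier) : algRep n wt g = coeffRepGL ℂ n wt (g : GL (Fin n) ℂ) := rfl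

/-- The Weyl sub-representation of `cStdPowRep`, typed on `V_wt(ℂ)`. [folklore] -/
def weylAlgRep : Representation ℂ (GLC n).carrier (GLnCohomology.CoeffModule ℂ n wt) :=
  show Representation ℂ (GLC n).carrier ↥(weylModule ℂ (Fin n) (GLnCohomology.coeffPartition wt)) from
    (cStdPowRep n (GLnCohomology.coeffDegree wt)).subrepresentation
      (weylModule ℂ (Fin n) (GLnCohomology.coeffPartition wt)) (cWeylModule_le_comap n _)

/-- `algRep` is the `det^{λ_{n-1}}`-twist of the Weyl sub-representation. [folklore] -/
theorem algRep_eq :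
    algRep n wt = twist (GLC n) (weylAlgRep n wt) (RealMatrixGroup.detChar (GLC n) (AlgHom.id ℝ ℂ) (GLnCohomology.lowestEntry wt)) := by
  refine MonoidHom.ext fun g => LinearMap.ext fun w => ?_
  rw [algRep_apply, GLnCohomology.coeffRepGL_apply, twist_apply, RealMatrixGroup.detChar_apply, Units.val_zpow_eq_zpow_val]
  congr 1

/-- **The differential of `V_wt(ℂ)` on the Lie algebra of `GLC n`**: Leibniz differential
restricted to the Weyl module plus `λ_{n-1} tr`. [cite: BorelWallach2000, 0 §2.3] -/
def algLieG : (GLC n).lie →ₗ⁅ℝ⁆ Module.End ℂ (GLnCohomology.CoeffModule ℂ n wt) :=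
  twistLie (E := GLnCohomology.CoeffModule ℂ n wt) (GLC n)
    (show (GLC n).lie →ₗ⁅ℝ⁆ Module.End ℂ (GLnCohomology.CoeffModule ℂ n wt) from
      GKSubmodule.subLie (GLC n) (cStdPowLie n (GLnCohomology.coeffDegree wt))
        (weylModule ℂ (Fin n) (GLnCohomology.coeffPartition wt))
        ((isDifferentiableRep_cStdPow n _).le_comap_of_stable (cWeylModule_le_comap n _)))
    (RealMatrixGroup.detCharLie (GLC n) (AlgHom.id ℝ ℂ) (GLnCohomology.lowestEntry wt))

/-- The Weyl factor is differentiable. [cite: BorelWallach2000, 0 §2.3] -/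
theorem isDifferentiableRep_weylAlg :
    IsDifferentiableRep (GLC n) (weylAlgRep n wt)
      (show (GLC n).lie →ₗ⁅ℝ⁆ Module.End ℂ (GLnCohomology.CoeffModule ℂ n wt) from
        GKSubmodule.subLie (GLC n) (cStdPowLie n (GLnCohomology.coeffDegree wt))
          (weylModule ℂ (Fin n) (GLnCohomology.coeffPartition wt))
          ((isDifferentiableRep_cStdPow n _).le_comap_of_stable (cWeylModule_le_comap n _))) :=
  (isDifferentiableRep_cStdPow n _).subrepresentation (cWeylModule_le_comap n _)

/-- **`V_wt(ℂ)` is a differentiable representation of `GLₙ(ℂ)` with differential `algLieG`.**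
[cite: BorelWallach2000, 0 §2.3] -/
theorem isDifferentiableRep_alg : IsDifferentiableRep (GLC n) (algRep n wt) (algLieG n wt) := by
  rw [algRep_eq]
  exact (isDifferentiableRep_weylAlg n wt).twist
    (isDifferentiableRep_detChar (GLC n) (AlgHom.id ℝ ℂ) _ continuous_id)

/-! ### `A = dV_wt` on `𝔤𝔩ₙ(ℂ)` -/

/-- **The differential `A = dV_wt : 𝔤𝔩ₙ(ℂ) → End V_wt(ℂ)`** (a morphism of real Lie algebras;
complex-linear by `algDiff_smul`). [cite: BorelWallach2000, 0 §2.3] -/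
def algDiff : Matrix (Fin n) (Fin n) ℂ →ₗ⁅ℝ⁆ Module.End ℂ (GLnCohomology.CoeffModule ℂ n wt) :=
  (algLieG n wt).comp (toLie n)

/-- **`A(Y) = L(Y) + λ_{n-1} tr(Y)` on underlying tensors.** [cite: BorelWallach2000, 0 §2.3] -/
theorem tens_algDiff (Y : Matrix (Fin n) (Fin n) ℂ) (v : GLnCohomology.CoeffModule ℂ n wt) :
    tens wt (algDiff n wt Y v) =
      leib n (coeffDegree wt) Y (tens wt v) + ((lowestEntry wt : ℂ) * Y.trace) • tens wt v := by
  rw [← coe_toLie n Y, ← cStdPowLie_eq_leib]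
  rw [show ((toLie n Y : (GLC n).lie) : Matrix (Fin n) (Fin n) ℂ).trace =
      (((toLie n Y : (GLC n).lie) : Matrix (Fin n) (Fin n) ℂ).map (AlgHom.id ℝ ℂ)).trace by
    rw [AlgHom.coe_id, Matrix.map_id]]
  rfl

/-- **`A` is complex-linear.** [folklore] -/
theorem algDiff_smul (c : ℂ) (Y : Matrix (Fin n) (Fin n) ℂ) : algDiff n wt (c • Y) = c • algDiff n wt Y := by
  refine LinearMap.ext fun v => tens_injective wt ?_
  rw [LinearMap.smul_apply, tens_algDiff]
  change _ = ((tens wt (c • algDiff n wt Y v) : TensorPower ℂ (coeffDegree wt) (Fin n → ℂ)))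
  have hsm : tens wt (c • algDiff n wt Y v) = c • tens wt (algDiff n wt Y v) := rfl
  rw [hsm, tens_algDiff, leib_smul, Matrix.trace_smul, smul_eq_mul, LinearMap.smul_apply, smul_add, smul_smul,
    mul_left_comm]

/-- **The factor differential at any embedding is `A ∘ τ̃`**: `dV_wt(τ̃ ·)(X) = A(X.map τ̃)` for the
factor `factorLie K n wt τ` of `ArchCoefficientModule`. [cite: BorelWallach2000, 0 §2.3] -/
theorem factorLie_eq_algDiff {K : Type} [Field K] [NumberField K] (τ : K →+* ℂ) (X : (archGroupGL n K).lie) :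
    factorLie K n wt τ X = algDiff n wt ((X : Matrix (Fin n) (Fin n) (mixedSpace K)).map (embeddingExt τ)) := by
  refine LinearMap.ext fun v => tens_injective wt ?_
  rw [tens_factorLie, tens_algDiff]

/-- **`V(g) A(Y) V(g)⁻¹ = A(g Y g⁻¹)`.** [cite: BorelWallach2000, 0 §2.5 1)] -/
theorem coeffRepGL_conj_algDiff (g : GL (Fin n) ℂ) (Y : Matrix (Fin n) (Fin n) ℂ) :
    coeffRepGL ℂ n wt g ∘ₗ algDiff n wt Y ∘ₗ coeffRepGL ℂ n wt g⁻¹ =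
      algDiff n wt ((g : Matrix (Fin n) (Fin n) ℂ) * Y * ((g⁻¹ : GL (Fin n) ℂ) : Matrix (Fin n) (Fin n) ℂ)) := by
  have h := (isDifferentiableRep_alg n wt).conj_dτ (toGLC n g) (toLie n Y)
  have e : (GLC n).Ad (toGLC n g) (toLie n Y) =
      toLie n ((g : Matrix (Fin n) (Fin n) ℂ) * Y * ((g⁻¹ : GL (Fin n) ℂ) : Matrix (Fin n) (Fin n) ℂ)) :=
    Subtype.ext (by rw [Ad_apply_coe]; rfl)
  rw [e] at h
  exact h

/-! ### The Casimir operator `C^alg` and its scalar -/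

/-- **The Casimir operator `C^alg = ∑_{a,b} A(E_ab) A(E_ba)` of `V_wt(ℂ)`.** [cite: Knapp2002, §V.4 (5.24)] -/
def casAlgD : Module.End ℂ (GLnCohomology.CoeffModule ℂ n wt) :=
  ∑ a : Fin n, ∑ b : Fin n, algDiff n wt (Matrix.single a b 1) * algDiff n wt (Matrix.single b a 1)

/-- `A(C₊) = 2 C^alg`. [folklore] -/
theorem lift_algDiff_casPlus : lift ℝ (algDiff n wt) (casPlus n) = (2 : ℂ) • casAlgD n wt := by
  rw [lift_casPlus_eq_sum, casAlgD, Finset.smul_sum]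
  refine Finset.sum_congr rfl fun a _ => ?_
  rw [Finset.smul_sum]
  refine Finset.sum_congr rfl fun b _ => ?_
  rw [single_I, single_I, algDiff_smul, algDiff_smul, smul_mul_smul_comm, I_mul_I, neg_one_smul, sub_neg_eq_add,
    two_smul]

/-- `A(C₊)` commutes with `V_wt(GLₙ(ℂ))`. [cite: Knapp2002, §V.4 Prop. 5.24] -/
theorem lift_algDiff_casPlus_comm (g : GL (Fin n) ℂ) :
    lift ℝ (algDiff n wt) (casPlus n) ∘ₗ coeffRepGL ℂ n wt g = coeffRepGL ℂ n wt g ∘ₗ lift ℝ (algDiff n wt) (casPlus n) := by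
  set ρg := coeffRepGL ℂ n wt g with hρg
  set ρg' := coeffRepGL ℂ n wt g⁻¹ with hρg'
  have hinv : ρg' * ρg = 1 := by rw [hρg, hρg', ← map_mul, inv_mul_cancel, map_one]
  have hconj : ∀ Y, ρg * algDiff n wt Y * ρg' =
      algDiff n wt ((g : Matrix (Fin n) (Fin n) ℂ) * Y * ((g⁻¹ : GL (Fin n) ℂ) : Matrix (Fin n) (Fin n) ℂ)) :=
    fun Y => by rw [mul_assoc]; exact coeffRepGL_conj_algDiff n wt g Y
  have key := congrArg (TensorProduct.lift (prodBilin (algDiff n wt) (algDiff n wt)))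
    (sum_adEquiv_cplxBasis_tmul_adEquiv_dualRe (n := n) g)
  simp only [map_sum, TensorProduct.lift.tmul, prodBilin_apply, adEquiv_apply] at key
  rw [sum_rho_cplxBasis_mul_rho_dualRe] at key
  have hc : ρg * lift ℝ (algDiff n wt) (casPlus n) * ρg' = lift ℝ (algDiff n wt) (casPlus n) := by
    conv_lhs => rw [← sum_rho_cplxBasis_mul_rho_dualRe]
    rw [Finset.mul_sum, Finset.sum_mul, ← key]
    refine Finset.sum_congr rfl fun x _ => ?_
    rw [← hconj, ← hconj]
    simp only [mul_assoc]
    rw [← mul_assoc ρg' ρg, hinv, one_mul]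
  change lift ℝ (algDiff n wt) (casPlus n) * ρg = ρg * lift ℝ (algDiff n wt) (casPlus n)
  conv_lhs => rw [← hc]
  rw [mul_assoc (ρg * lift ℝ (algDiff n wt) (casPlus n)), hinv, mul_one]

/-- **`C^alg` is a scalar on `V_wt(ℂ)`** (Schur's lemma for the irreducible Weyl module).
[cite: FultonHarrisGTM129, Thm. 6.3 (4)] -/
theorem exists_casAlgD_eq_smul :
    ∃ c : ℂ, casAlgD n wt = c • (1 : Module.End ℂ (GLnCohomology.CoeffModule ℂ n wt)) := by
  haveI : FiniteDimensional ℂ (GLnCohomology.CoeffModule ℂ n wt) := finiteDimensional_coeffModule n wt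
  haveI : Representation.IsIrreducible (weylRepCoeff ℂ n wt) :=
    isIrreducible_weylRep_holds ℂ (Fin n) (coeffPartition wt) (card_parts_coeffPartition_le wt)
  set P := lift ℝ (algDiff n wt) (casPlus n) with hP
  have hcomm : ∀ g : GL (Fin n) ℂ, P ∘ₗ weylRepCoeff ℂ n wt g = weylRepCoeff ℂ n wt g ∘ₗ P := by
    intro g
    have hu : ∀ v, weylRepCoeff ℂ n wt g v =
        (((Matrix.GeneralLinearGroup.det g ^ lowestEntry wt : ℂˣ) : ℂ)⁻¹) • coeffRepGL ℂ n wt g v := fun v => by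
      rw [coeffRepGL_apply, smul_smul, inv_mul_cancel₀ (Units.ne_zero _), one_smul]
    refine LinearMap.ext fun v => ?_
    rw [LinearMap.comp_apply, LinearMap.comp_apply, hu, hu, map_smul]
    congr 1
    exact LinearMap.congr_fun (lift_algDiff_casPlus_comm n wt g) v
  obtain ⟨p, hp⟩ : ∃ p : ℂ, P = p • (1 : Module.End ℂ (GLnCohomology.CoeffModule ℂ n wt)) := by
    let f : Representation.IntertwiningMap (weylRepCoeff ℂ n wt) (weylRepCoeff ℂ n wt) := ⟨P, hcomm⟩
    obtain ⟨p, hp⟩ :=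
      (Representation.IsIrreducible.algebraMap_intertwiningMap_bijective_of_isAlgClosed (ρ := weylRepCoeff ℂ n wt)).2 f
    refine ⟨p, ?_⟩
    have h := congrArg Representation.IntertwiningMap.toLinearMap hp
    rw [Representation.IntertwiningMap.algebraMap_apply, Representation.IntertwiningMap.toLinearMap_smul] at h
    exact h.symm
  refine ⟨2⁻¹ * p, ?_⟩
  rw [mul_smul, ← hp, hP, lift_algDiff_casPlus, smul_smul, inv_mul_cancel₀ two_ne_zero, one_smul]

end AlgDiff

end Literature.NumberTheory.Automorphic

end
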